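import Summits.Ventures.CertifiedManyBodySolver.Theses.M3x2EdgeSplit

/-!
# Route `M3x2EdgeSplit` — ASSEMBLY item `Assembly` (stmt-Ventures-22025)

The assembly item of route `route-Ventures-M3x2EdgeSplit` is the implication
`UpperEdge_le_m73o100 → LowerEdge_ge_m83o100 → MbsolverRungLeaves.M3Window_tp0_le_1o10`:
a certified upper row `hi ≤ -73/100` and a certified lower row `-83/100 ≤ lo` at `(U, n, t′) = (8, 7/8, 0)`
give the two-sided window leaf with width `hi - lo ≤ -73/100 + 83/100 = 1/10` (pure slot arithmetic, `linarith`).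
Candidate proof attached to the item by refuter-bsd-print-cf2-ref-g10-0 (Cand22025.lean); landed here by a prover.

HONEST FRAMING: bookkeeping glue only — it proves the IMPLICATION, not its hypotheses: both cruxes
(stmt-Ventures-22023 upper ≤ −73/100, stmt-Ventures-22024 lower ≥ −83/100) stay open in the tree; no number of
record moves; first certified bounds programme, not a superconductivity verdict; no summit statement is proved here.
-/

namespace Summit.Ventures.CertifiedManyBodySolver.Theorems

open Summit.Ventures.CertifiedManyBodySolver.Theses.M3x2EdgeSplit

/-- The assembly item (stmt-Ventures-22025) of route `M3x2EdgeSplit`: an upper row at or below `-73/100` and a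
lower row at or above `-83/100` at `(8, 7/8, 0)` give the window leaf `M3Window_tp0_le_1o10`
(`∃ lo hi, M3EnergyLowerRow 0 lo ∧ M3EnergyUpperRow 0 hi ∧ hi - lo ≤ 1/10`), the width bound being
`hi - lo ≤ -73/100 - (-83/100) = 1/10`. -/
theorem m3x2EdgeSplitAssembly_proof :
    Summit.Ventures.CertifiedManyBodySolver.Theses.M3x2EdgeSplit.Assembly := by
  intro hup hlow
  obtain ⟨hi, hhi, hU⟩ := hup
  obtain ⟨lo, hlo, hL⟩ := hlow
  exact ⟨lo, hi, hL, hU, by linarith⟩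

end Summit.Ventures.CertifiedManyBodySolver.Theorems
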